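import Summits.Langlands.Langlands.Theses.BianchiDeligneSerre

/-!
# Strategy-census sketches for crux C2 = `ArithmeticityArtinTypeK` (item stmt-Langlands-15869)

Crux-strategist unit `cstrat-stmt-Langlands-15869-r1` (route re-audit bin RESTATED). This file TYPES the
candidate decompositions discussed in `STRATEGY-CENSUS.md` and proves their assemblies, so that the
census verdicts (a)/(b)/(c) are about checked objects:

* D1 (conjunct split along the two printed conjectures):
  `LArithmeticIntegralArtinTypeK` (Buzzard–Gee Conj. 3.1.5 + integrality, sector) and
  `ClozelConjugatesEmb` (Clozel's conjugation conjecture, sector, embedding form) ⟹ C2 by a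
  two-line seam (`C2_of_conjuncts_emb`) — violates (b);
  the `Aut(ℂ)` form `ClozelConjugatesAut` needs only the field-theory lemma
  `EmbeddingExtendsToAut` (`C2_of_conjuncts_aut`, 12 lines) — non-trivial only by artefact.
* D5 (Deligne–Serre (2.7) anatomy: integral Hecke module + rational-eigencharacter lemma):
  `IntegralHeckeModuleArtinTypeK` and `RationalEigencharacterMatrix` ⟹ C2
  (`C2_of_module`, genuine glue) — passes (a)/(b) mechanically, but the open piece
  `IntegralHeckeModuleArtinTypeK` is C2 REWORDED (C2 ⟹ it by `E ⊗_ℚ ℂ ≅ ℂ^{[E:ℚ]}`, census §Decomposition).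
-/

namespace Summit.Langlands.Langlands.Cruxes.ArithmeticityArtinTypeK.StrategyCensus

open Summit.Langlands.Langlands.Theses.BianchiDeligneSerre
open Literature.NumberTheory.Automorphic IsDedekindDomain NumberField
open scoped Matrix

noncomputable section

/-- Artin type (the predicate inlined everywhere in the route file): an infinity type all of whose
exponents are `(0,0)` — `π_∞ = PS(1,1)`, the `λ = 1` Maass forms on `ℍ³`. [cite: BuzzardGeeLMS2014, §3.1] -/
def IsArtinType {K : Type} [Field K] [NumberField K] {hcpt : isCompact_glFiniteIntegralLevel 2 K}
    (π : CuspidalAutomorphicRepData 2 K hcpt) : Prop :=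
  ∃ T : InfinityType K 2, π.1.HasInfinityType T ∧ ∀ σ : K →+* ℂ, ∀ w ∈ T σ, w.a = 0 ∧ w.b = 0

/-! ## D1 — conjunct split along the two printed conjectures -/

/-- D1 piece 1: L-arithmeticity with integrality for the Artin-type sector (Buzzard–Gee Conj. 3.1.5,
restricted; first clause of C2 verbatim). [cite: BuzzardGeeLMS2014, Conj. 3.1.5] -/
def LArithmeticIntegralArtinTypeK : Prop :=
  ∀ (K : Type) [Field K] [NumberField K], IsTotallyComplex K → Module.finrank ℚ K = 2 →
    ∀ (hcpt : isCompact_glFiniteIntegralLevel 2 K) (π : CuspidalAutomorphicRepData 2 K hcpt),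
      IsArtinType π →
        ∃ (E : IntermediateField ℚ ℂ) (s d : HeightOneSpectrum (𝓞 K) → E), FiniteDimensional ℚ E ∧
          ∀ᶠ v : HeightOneSpectrum (𝓞 K) in Filter.cofinite, IsIntegral ℤ (s v) ∧ IsIntegral ℤ (d v) ∧
            ∃ α : Multiset ℂ, π.1.HasSatakeParamAt v α ∧ ((s v : E) : ℂ) = α.sum ∧ ((d v : E) : ℂ) = α.prod

/-- D1 piece 2 (embedding form): Clozel's conjugation conjecture for the sector — every `ℚ`-embedding
of a field of definition of the unramified Hecke eigensystem of an Artin-type `π` carries it to the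
eigensystem of another Artin-type cuspidal `π'` (second clause of C2, universally quantified over the
arithmetic data instead of existentially tied). [cite: Clozel1990, Conj. 4.5] -/
def ClozelConjugatesEmb : Prop :=
  ∀ (K : Type) [Field K] [NumberField K], IsTotallyComplex K → Module.finrank ℚ K = 2 →
    ∀ (hcpt : isCompact_glFiniteIntegralLevel 2 K) (π : CuspidalAutomorphicRepData 2 K hcpt),
      IsArtinType π →
        ∀ (E : IntermediateField ℚ ℂ) (s d : HeightOneSpectrum (𝓞 K) → E),
          (∀ᶠ v : HeightOneSpectrum (𝓞 K) in Filter.cofinite,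
            ∃ α : Multiset ℂ, π.1.HasSatakeParamAt v α ∧ ((s v : E) : ℂ) = α.sum ∧ ((d v : E) : ℂ) = α.prod) →
          ∀ τ : E →ₐ[ℚ] ℂ, ∃ π' : CuspidalAutomorphicRepData 2 K hcpt, IsArtinType π' ∧
            ∀ᶠ v : HeightOneSpectrum (𝓞 K) in Filter.cofinite,
              ∃ α' : Multiset ℂ, π'.1.HasSatakeParamAt v α' ∧ τ (s v) = α'.sum ∧ τ (d v) = α'.prod

/-- **The seam of D1 is trivial**: two lines of logic. This is the evidence that D1 violates
requirement (b) of the BC2 redirect exemption. [folklore] -/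
theorem C2_of_conjuncts_emb (h₁ : LArithmeticIntegralArtinTypeK) (h₂ : ClozelConjugatesEmb) :
    ArithmeticityArtinTypeK := by
  intro K _ _ hK hK2 hcpt π hπ
  obtain ⟨E, s, d, hE, hae⟩ := h₁ K hK hK2 hcpt π hπ
  exact ⟨E, s, d, hE, hae, fun τ => h₂ K hK hK2 hcpt π hπ E s d (hae.mono fun v hv => hv.2.2) τ⟩

/-- D1 piece 2 (`Aut(ℂ)` form): for every field automorphism `σ` of `ℂ`, the `σ`-conjugate of the
unramified Hecke eigensystem of an Artin-type cuspidal `π` is that of an Artin-type cuspidal `π'`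
(Clozel 1990, conjugation of `π_f` by `Aut(ℂ)`, restricted to the sector; no algebraicity assumed). [cite: Clozel1990, §3 and Conj. 4.5] -/
def ClozelConjugatesAut : Prop :=
  ∀ (K : Type) [Field K] [NumberField K], IsTotallyComplex K → Module.finrank ℚ K = 2 →
    ∀ (hcpt : isCompact_glFiniteIntegralLevel 2 K) (π : CuspidalAutomorphicRepData 2 K hcpt),
      IsArtinType π → ∀ σ : ℂ ≃+* ℂ, ∃ π' : CuspidalAutomorphicRepData 2 K hcpt, IsArtinType π' ∧
        ∀ᶠ v : HeightOneSpectrum (𝓞 K) in Filter.cofinite, ∀ α : Multiset ℂ, π.1.HasSatakeParamAt v α →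
          ∃ α' : Multiset ℂ, π'.1.HasSatakeParamAt v α' ∧ σ α.sum = α'.sum ∧ σ α.prod = α'.prod

/-- Field-theory lemma (known; Lang, *Algebra*, Ch. VIII §1 / Milne FT Thm 6.8 style): every
`ℚ`-embedding of a number field `E ⊂ ℂ` into `ℂ` extends to an automorphism of `ℂ`
(transcendence bases + isomorphism of algebraic closures). [folklore] -/
def EmbeddingExtendsToAut : Prop :=
  ∀ (E : IntermediateField ℚ ℂ), FiniteDimensional ℚ E → ∀ τ : E →ₐ[ℚ] ℂ,
    ∃ σ : ℂ ≃+* ℂ, ∀ x : E, σ (x : ℂ) = τ x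

/-- Assembly of the `Aut(ℂ)` form of D1: the only content beyond the trivial seam is the extension
lemma `EmbeddingExtendsToAut`, which is unrelated to the crux (12 lines). [folklore] -/
theorem C2_of_conjuncts_aut (h₁ : LArithmeticIntegralArtinTypeK) (h₂ : ClozelConjugatesAut)
    (h₃ : EmbeddingExtendsToAut) : ArithmeticityArtinTypeK := by
  intro K _ _ hK hK2 hcpt π hπ
  obtain ⟨E, s, d, hE, hae⟩ := h₁ K hK hK2 hcpt π hπ
  refine ⟨E, s, d, hE, hae, fun τ => ?_⟩
  obtain ⟨σ, hσ⟩ := h₃ E hE τ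
  obtain ⟨π', hπ', hv⟩ := h₂ K hK hK2 hcpt π hπ σ
  refine ⟨π', hπ', ?_⟩
  filter_upwards [hae, hv] with v hv1 hv2
  obtain ⟨-, -, α, hα, hs, hd⟩ := hv1
  obtain ⟨α', hα', h1, h2⟩ := hv2 α hα
  exact ⟨α', hα', by rw [← hσ, hs, h1], by rw [← hσ, hd, h2]⟩

/-! ## D5 — Deligne–Serre (2.7) anatomy: integral Hecke module + rational eigencharacters -/

/-- D5 open piece: the unramified Hecke eigensystem `(α_v+β_v, α_vβ_v)_{v ∉ S}` of an Artin-type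
cuspidal `π` is realised by a common eigenvector `w ∈ ℂ^m` of pairwise commuting INTEGER matrices
`T_v, D_v`, and conversely every common complex eigenvector of the family is the eigensystem of an
Artin-type cuspidal `π'` almost everywhere (an "integral model of the Artin-type Hecke packet through
`π`"; Deligne–Serre 1974 (2.7) transported as bare existence). [cite: DeligneSerre1974, (2.7)] -/
def IntegralHeckeModuleArtinTypeK : Prop :=
  ∀ (K : Type) [Field K] [NumberField K], IsTotallyComplex K → Module.finrank ℚ K = 2 →
    ∀ (hcpt : isCompact_glFiniteIntegralLevel 2 K) (π : CuspidalAutomorphicRepData 2 K hcpt),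
      IsArtinType π →
        ∃ (S : Finset (HeightOneSpectrum (𝓞 K))) (m : ℕ)
          (T D : HeightOneSpectrum (𝓞 K) → Matrix (Fin m) (Fin m) ℤ) (w : Fin m → ℂ),
          w ≠ 0 ∧
          (∀ v v' : HeightOneSpectrum (𝓞 K),
            Commute (T v) (T v') ∧ Commute (T v) (D v') ∧ Commute (D v) (D v')) ∧
          (∀ v, v ∉ S → ∃ α : Multiset ℂ, π.1.HasSatakeParamAt v α ∧
            ((T v).map (Int.castRingHom ℂ)) *ᵥ w = α.sum • w ∧
            ((D v).map (Int.castRingHom ℂ)) *ᵥ w = α.prod • w) ∧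
          ∀ w' : Fin m → ℂ, w' ≠ 0 →
            (∀ v, v ∉ S → ∃ c d : ℂ, ((T v).map (Int.castRingHom ℂ)) *ᵥ w' = c • w' ∧
              ((D v).map (Int.castRingHom ℂ)) *ᵥ w' = d • w') →
            ∃ π' : CuspidalAutomorphicRepData 2 K hcpt, IsArtinType π' ∧
              ∀ᶠ v : HeightOneSpectrum (𝓞 K) in Filter.cofinite, v ∉ S →
                ∃ α' : Multiset ℂ, π'.1.HasSatakeParamAt v α' ∧
                  ((T v).map (Int.castRingHom ℂ)) *ᵥ w' = α'.sum • w' ∧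
                  ((D v).map (Int.castRingHom ℂ)) *ᵥ w' = α'.prod • w'

/-- D5 support piece (pure linear algebra, provable now; = route RationalPeriodQuarter's
`RationalEigencharacterLemma` for commuting integer matrices, plus integrality and conjugates): the
eigenvalues of a common complex eigenvector of pairwise commuting integer matrices are algebraic
integers of ONE number field `E ⊂ ℂ`, and every `ℚ`-embedding of `E` carries them to the eigenvalues
of another common eigenvector. [cite: DeligneSerre1974, (2.7) and Lemme 6.5] -/
def RationalEigencharacterMatrix : Prop :=
  ∀ (m : ℕ) (ι : Type) (M : ι → Matrix (Fin m) (Fin m) ℤ), (∀ i j, Commute (M i) (M j)) →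
    ∀ (w : Fin m → ℂ) (c : ι → ℂ), w ≠ 0 → (∀ i, ((M i).map (Int.castRingHom ℂ)) *ᵥ w = c i • w) →
      ∃ E : IntermediateField ℚ ℂ, FiniteDimensional ℚ E ∧ ∃ c' : ι → E,
        (∀ i, ((c' i : E) : ℂ) = c i) ∧ (∀ i, IsIntegral ℤ (c' i)) ∧
        ∀ τ : E →ₐ[ℚ] ℂ, ∃ w' : Fin m → ℂ, w' ≠ 0 ∧
          ∀ i, ((M i).map (Int.castRingHom ℂ)) *ᵥ w' = τ (c' i) • w'

/-- **Assembly of D5** (genuine glue, sorry-free): integral Hecke module + rational-eigencharacter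
lemma ⟹ C2. Index the family by `{v // v ∉ S} ⊕ {v // v ∉ S}` (`inl ↦ T_v`, `inr ↦ D_v`), read off
`E`, `s`, `d` from the lemma, and feed the conjugate eigenvector back into the converse clause. [cite: DeligneSerre1974, (2.7)] -/
theorem C2_of_module (h₁ : IntegralHeckeModuleArtinTypeK) (h₃ : RationalEigencharacterMatrix) :
    ArithmeticityArtinTypeK := by
  intro K _ _ hK hK2 hcpt π hπ
  obtain ⟨S, m, T, D, w, hw, hcomm, heig, hconv⟩ := h₁ K hK hK2 hcpt π hπ
  classical
  -- the commuting family, indexed by two copies of the places outside `S`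
  let ι : Type := {v : HeightOneSpectrum (𝓞 K) // v ∉ S} ⊕ {v : HeightOneSpectrum (𝓞 K) // v ∉ S}
  let M : ι → Matrix (Fin m) (Fin m) ℤ := Sum.elim (fun v => T v.1) (fun v => D v.1)
  have hM : ∀ i j : ι, Commute (M i) (M j) := by
    rintro (v | v) (v' | v')
    · exact (hcomm v.1 v'.1).1
    · exact (hcomm v.1 v'.1).2.1
    · exact (hcomm v'.1 v.1).2.1.symm
    · exact (hcomm v.1 v'.1).2.2
  choose α hα hT hD using heig
  let c : ι → ℂ := Sum.elim (fun v => (α v.1 v.2).sum) (fun v => (α v.1 v.2).prod)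
  have hc : ∀ i, ((M i).map (Int.castRingHom ℂ)) *ᵥ w = c i • w := by
    rintro (⟨v, hv⟩ | ⟨v, hv⟩)
    · exact hT v hv
    · exact hD v hv
  obtain ⟨E, hE, c', hc', hint, hconj⟩ := h₃ m ι M hM w c hw hc
  -- the arithmetic data
  let s : HeightOneSpectrum (𝓞 K) → E := fun v => if hv : v ∉ S then c' (Sum.inl ⟨v, hv⟩) else 0
  let d : HeightOneSpectrum (𝓞 K) → E := fun v => if hv : v ∉ S then c' (Sum.inr ⟨v, hv⟩) else 0
  have hS : ∀ᶠ v : HeightOneSpectrum (𝓞 K) in Filter.cofinite, v ∉ S := S.eventually_cofinite_notMem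
  refine ⟨E, s, d, hE, ?_, ?_⟩
  · filter_upwards [hS] with v hv
    have hs : s v = c' (Sum.inl ⟨v, hv⟩) := dif_pos hv
    have hd : d v = c' (Sum.inr ⟨v, hv⟩) := dif_pos hv
    refine ⟨hs ▸ hint _, hd ▸ hint _, α v hv, hα v hv, ?_, ?_⟩
    · rw [hs, hc']; rfl
    · rw [hd, hc']; rfl
  · intro τ
    obtain ⟨w', hw', heig'⟩ := hconj τ
    obtain ⟨π', hπ', hv'⟩ := hconv w' hw' fun v hv =>
      ⟨τ (c' (Sum.inl ⟨v, hv⟩)), τ (c' (Sum.inr ⟨v, hv⟩)), heig' (Sum.inl ⟨v, hv⟩), heig' (Sum.inr ⟨v, hv⟩)⟩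
    refine ⟨π', hπ', ?_⟩
    filter_upwards [hv', hS] with v hv hvS
    obtain ⟨α', hα', h1, h2⟩ := hv hvS
    have hs : s v = c' (Sum.inl ⟨v, hvS⟩) := dif_pos hvS
    have hd : d v = c' (Sum.inr ⟨v, hvS⟩) := dif_pos hvS
    refine ⟨α', hα', ?_, ?_⟩
    · rw [hs]
      exact smul_left_injective ℂ hw' (((heig' (Sum.inl ⟨v, hvS⟩)).symm.trans h1))
    · rw [hd]
      exact smul_left_injective ℂ hw' (((heig' (Sum.inr ⟨v, hvS⟩)).symm.trans h2))

end

end Summit.Langlands.Langlands.Cruxes.ArithmeticityArtinTypeK.StrategyCensus
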